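import Summits.AnomalousDissipation.AnomalousDissipation.Theorems.SawtoothPulseCascadeK1LocalisedCascadeLedgerScheduleFrom
import Summits.AnomalousDissipation.AnomalousDissipation.Theorems.SawtoothPulseCascadeK1LocalisedCascadeLedgerIterate
import Summits.AnomalousDissipation.AnomalousDissipation.Theorems.SawtoothPulseCascadeK1LocalisedCascadeLedgerCascadeHFrom
import Summits.AnomalousDissipation.AnomalousDissipation.Theorems.SawtoothPulseCascadeK1LocalisedCascadeLedgerCascadeVFrom

/-!
# K1loc, line `Spectral` / SeqCone — helper: THE THIN-START CLOSERS (S-B assembly «from phase i₀», top)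

Helper file of the prover lane on the crux `K1LocalisedCascade` (stmt-AnomalousDissipation-19491), route
`SawtoothPulseCascade` (S-B/S-C assembly seat).  `…LedgerClose` / `…LedgerK1Localised` / `…LedgerIterate` close the cascade
ledger along the LITERAL schedule `L_j = L₀ρ(L₀)^j`, `L₀ ≥ 1000` fixed for all start phases `i₀`; the hand-over audit
(evidence on the item, k1loc-p3 g2) shows that the tracked radius `1.004·L₀ρ^{i₀}` then lies ABOVE the deterministic
frequency floor `(γ²−3)^{i₀}` of the inviscid iterate, so the start socket cannot be met before `i₀ ≈ 300`.  The THIN START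
decouples the two roles of `L₀` (`…LedgerScheduleFrom`: rate frozen at `ρ₀ = ρ(L_min)`, radii `L_j = L₀ρ₀^j` with a small
scale `0 < L₀ ≤ 1`, side conditions only for the phases `j ≥ i₀` where `L_min ≤ L_j`; `…LedgerErrorScale` +
`…LedgerCascadeHFrom/VFrom`: the half-slot errors scale like `1/L₀`).  This file is the top of that chain:
* §1 `rho_mul_theta_lt_rate` — the one new inequality: `ρ₀·θ < γ² − 3` for `5 ≤ γ ≤ 8` (`θ = (max(16/ρ₀, ½))^{1/4}`;
  from `ρ₀ ≤ γ² − 5/2 ≤ (45/44)(γ²−3)`: `16ρ₀³ < (γ²−3)⁴`, `ρ₀⁴ < 2(γ²−3)⁴`), so a ledger started at radius `c(γ²−3)^{i₀}`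
  (scale `L₀ = c(γ²−3)^{i₀}/ρ₀^{i₀}`) has error tail `(K/c)(ρ₀θ/(γ²−3))^{i₀}/(1−θ) → 0`;
* §2 bookkeeping: the scaled constants along the thin schedule, and the three eventual conditions in `i₀` (scale `≤ 1`,
  radius `≥ L_min`, budget);
* §3 **`From.highModeConcentration_of_firstGoodPiece`** — `…K1Ledger.highModeConcentration_of_geometric_ledger'` fed with the
  «from phase `i₀`» half-slots: constants `K_ε, K_ζ` INDEPENDENT of `L₀` and `i₀`, budget
  `√(q² + (K_ζ/L₀)θ^{i₀}/(1−θ)) + (K_ε/L₀)θ^{i₀}/(1−θ) < ‖θ₀‖` ⇒ the body of the registered stub for `(P, γ²−3, θ₀)`;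
* §4 **`k1Localised_of_thin_firstGoodPiece`** — for ANY `c > 0`: a UNIFORM first good piece (one level `q < ‖datum‖`, all
  `i₀ ≥ i₁`) for the start symbol with tracked radius `c(γ²−3)^{i₀}` ⇒ `K1Localised P (γ²−3)` (the closer picks `i₀`);
* §5 **`k1Localised_of_thin_iterate_bound`** — the same from ONE uniform bound on the explicit INVISCID ITERATES
  (`…K1Start.sqrt_tsum_symbol_sq_datum_le_of_inviscid`), the PDE-free S-D target of the thin chain.
Shape P throughout (`N₀ = 1`, `ρN = 2`, `d = 2`, `5 ≤ γ ≤ 8`, `0 < δ₀ ≤ 1/4` symbolic).  No definitions; nothing about the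
crux at `δ₀ = ¼` is claimed. [cite: DEIJ2022, (1.2)–(1.3)] [cite: ElgindiLissMattingly2025, §1.2 and §3.1] [problem: turb]
-/

-- `Summit.<Summit>.<Problem>`: single-conjunct summit, the duplicate namespace segment is deliberate.
set_option linter.dupNamespace false

noncomputable section

namespace Summit.AnomalousDissipation.AnomalousDissipation.Theorems.SawtoothPulseCascade.K1Ledger.From

open MeasureTheory Set Filter Topology UnitAddTorus Function
open scoped ENNReal
open Literature.Analysis Literature.Analysis.FunctionSpaces Literature.Analysis.FunctionSpaces.Torus Literature.Analysis.FluidPDE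
open Literature.Analysis.FluidPDE.Torus (highModeEnergy)
open Literature.Analysis.FluidPDE.ShearStage
open Literature.Analysis.FluidPDE.SawtoothCascade Literature.Analysis.FluidPDE.SawtoothCascade.CascadeParams
open Summit.AnomalousDissipation.AnomalousDissipation.Theorems.SawtoothPulseCascade.K1Symbol
open Summit.AnomalousDissipation.AnomalousDissipation.Theorems.SawtoothPulseCascade.K1Start
open Summit.AnomalousDissipation.AnomalousDissipation.Theorems.SawtoothPulseCascade.K1Ledger

/-! ## §1 The thin-start rate: `ρ₀·θ < γ² − 3` -/

/-- `ρ₀ ≤ γ² − 5/2 = (γ² − 3) + ½` (the loss-free growth factor without the `(1+ε)²` division). [folklore] -/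
theorem rho_le_rate_add_half {γ Lm : ℝ} (hγ : 5 ≤ γ) (hLm : 1000 ≤ Lm) :
    (γ ^ 2 - 5 / 2) / (1 + 1 / 250) ^ 2 - 1 / (2 * (1 + 1 / 250) * Lm) ≤ γ ^ 2 - 3 + 1 / 2 := by
  refine (rho_le_lambda (γ := γ) hLm).trans ?_
  have h : (γ ^ 2 - 5 / 2) / (1 + 1 / 250) ^ 2 ≤ γ ^ 2 - 5 / 2 := div_le_self (by nlinarith) (by norm_num)
  linarith

/-- **The thin-start rate.**  With `θ = (max(16/ρ₀, ½))^{1/4}` the product `ρ₀·θ` is still below the crux rate `γ² − 3`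
(`5 ≤ γ ≤ 8`, `L_min ≥ 1000`): numerically `ρ₀θ/(γ²−3) = 0.934 … 0.716`.  Equivalent to `16ρ₀³ < (γ²−3)⁴` and
`ρ₀⁴ < 2(γ²−3)⁴`, both consequences of `ρ₀ ≤ (γ²−3) + ½ ≤ (45/44)(γ²−3)`. [folklore] -/
theorem rho_mul_theta_lt_rate {γ Lm : ℝ} (hγ : 5 ≤ γ) (hγ' : γ ≤ 8) (hLm : 1000 ≤ Lm) :
    ((γ ^ 2 - 5 / 2) / (1 + 1 / 250) ^ 2 - 1 / (2 * (1 + 1 / 250) * Lm)) *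
        Real.sqrt (Real.sqrt (max (16 / ((γ ^ 2 - 5 / 2) / (1 + 1 / 250) ^ 2 - 1 / (2 * (1 + 1 / 250) * Lm))) (1 / 2))) <
      γ ^ 2 - 3 := by
  set ρ : ℝ := (γ ^ 2 - 5 / 2) / (1 + 1 / 250) ^ 2 - 1 / (2 * (1 + 1 / 250) * Lm) with hρ
  set r : ℝ := γ ^ 2 - 3 with hr
  have hρ0 : 0 < ρ := rho_pos hγ hγ' hLm
  have hr22 : 22 ≤ r := by rw [hr]; nlinarith
  have hr0 : 0 < r := by linarith
  have hρr : ρ ≤ 45 / 44 * r := by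
    have := rho_le_rate_add_half (γ := γ) hγ hLm
    rw [← hρ, ← hr] at this
    linarith
  -- `√√m < r/ρ` iff `m < (r/ρ)⁴`
  have hy : 0 < r / ρ := div_pos hr0 hρ0
  suffices h : Real.sqrt (Real.sqrt (max (16 / ρ) (1 / 2))) < r / ρ by
    calc ρ * Real.sqrt (Real.sqrt (max (16 / ρ) (1 / 2))) < ρ * (r / ρ) := mul_lt_mul_of_pos_left h hρ0
      _ = r := mul_div_cancel₀ _ hρ0.ne'
  rw [Real.sqrt_lt' hy, Real.sqrt_lt' (by positivity)]
  have h4 : ((r / ρ) ^ 2) ^ 2 = r ^ 4 / ρ ^ 4 := by rw [div_pow, div_pow]; ring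
  rw [h4]
  have hρ3 : ρ ^ 3 ≤ (45 / 44 * r) ^ 3 := pow_le_pow_left₀ hρ0.le hρr 3
  have hρ4 : ρ ^ 4 ≤ (45 / 44 * r) ^ 4 := pow_le_pow_left₀ hρ0.le hρr 4
  have hr3 : 0 < r ^ 3 := pow_pos hr0 3
  have hr4 : 0 < r ^ 4 := pow_pos hr0 4
  have hρ4p : 0 < ρ ^ 4 := pow_pos hρ0 4
  refine max_lt ?_ ?_
  · -- `16/ρ < r⁴/ρ⁴` iff `16ρ³ < r⁴`
    have h1 : 16 * ρ ^ 3 < r ^ 4 := by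
      calc 16 * ρ ^ 3 ≤ 16 * (45 / 44 * r) ^ 3 := by linarith
        _ = (16 * (45 / 44) ^ 3) * r ^ 3 := by ring
        _ < r * r ^ 3 := mul_lt_mul_of_pos_right (by norm_num; linarith) hr3
        _ = r ^ 4 := by ring
    rw [div_lt_div_iff₀ hρ0 hρ4p]
    have : r ^ 4 * ρ = ρ * r ^ 4 := mul_comm _ _
    nlinarith
  · rw [lt_div_iff₀ hρ4p]
    calc 1 / 2 * ρ ^ 4 ≤ 1 / 2 * (45 / 44 * r) ^ 4 := by linarith
      _ = (1 / 2 * (45 / 44) ^ 4) * r ^ 4 := by ring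
      _ < 1 * r ^ 4 := mul_lt_mul_of_pos_right (by norm_num) hr4
      _ = r ^ 4 := one_mul _

/-- `0 ≤ ρ₀θ/(γ² − 3) < 1`. [folklore] -/
theorem thinRate_nonneg_lt_one {γ Lm : ℝ} (hγ : 5 ≤ γ) (hγ' : γ ≤ 8) (hLm : 1000 ≤ Lm) :
    0 ≤ ((γ ^ 2 - 5 / 2) / (1 + 1 / 250) ^ 2 - 1 / (2 * (1 + 1 / 250) * Lm)) *
        Real.sqrt (Real.sqrt (max (16 / ((γ ^ 2 - 5 / 2) / (1 + 1 / 250) ^ 2 - 1 / (2 * (1 + 1 / 250) * Lm))) (1 / 2))) /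
        (γ ^ 2 - 3) ∧
    ((γ ^ 2 - 5 / 2) / (1 + 1 / 250) ^ 2 - 1 / (2 * (1 + 1 / 250) * Lm)) *
        Real.sqrt (Real.sqrt (max (16 / ((γ ^ 2 - 5 / 2) / (1 + 1 / 250) ^ 2 - 1 / (2 * (1 + 1 / 250) * Lm))) (1 / 2))) /
        (γ ^ 2 - 3) < 1 := by
  have hr0 : 0 < γ ^ 2 - 3 := by nlinarith
  exact ⟨div_nonneg (mul_nonneg (rho_pos hγ hγ' hLm).le (Real.sqrt_nonneg _)) hr0.le,
    (div_lt_one hr0).2 (rho_mul_theta_lt_rate hγ hγ' hLm)⟩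

/-! ## §2 Eventual conditions along the thin schedule `L₀(i) = c(γ²−3)^i/ρ₀^i` -/

/-- **The scaled error constants along the thin schedule**: `(K/L₀(i))·θ^i/(1−θ) = (K/(c(1−θ)))·(ρ₀θ/r)^i` for
`L₀(i) = c r^i/ρ₀^i`. [folklore] -/
theorem div_thinScale_mul_pow {K c r ρ θ : ℝ} (hc : c ≠ 0) (hr : r ≠ 0) (hρ : ρ ≠ 0) (hθ1 : 1 - θ ≠ 0) (i : ℕ) :
    K / (c * r ^ i / ρ ^ i) * θ ^ i / (1 - θ) = K / (c * (1 - θ)) * (ρ * θ / r) ^ i := by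
  rw [div_pow, mul_pow]
  field_simp

/-- **Eventual budget.**  For `0 ≤ q < E`, `K_ε, K_ζ ≥ 0` and a rate `0 ≤ ϑ < 1`, eventually
`√(q² + K_ζϑ^i) + K_εϑ^i < E`. [folklore] -/
theorem eventually_budget {E q Kε Kζ ϑ : ℝ} (hq : 0 ≤ q) (hqE : q < E) (hKε : 0 ≤ Kε) (hKζ : 0 ≤ Kζ) (hϑ0 : 0 ≤ ϑ)
    (hϑ1 : ϑ < 1) : ∀ᶠ i : ℕ in atTop, Real.sqrt (q ^ 2 + Kζ * ϑ ^ i) + Kε * ϑ ^ i < E := by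
  set m : ℝ := (E - q) / 2 with hm
  have hm0 : 0 < m := by rw [hm]; linarith
  set τ : ℝ := min (m ^ 2 / (Kζ + 1)) (m / (Kε + 1)) with hτ
  have hτ0 : 0 < τ := lt_min (by positivity) (by positivity)
  obtain ⟨n₀, hn₀⟩ := exists_pow_lt_of_lt_one hτ0 hϑ1
  refine eventually_atTop.2 ⟨n₀, fun i hi => ?_⟩
  have hϑi : ϑ ^ i < τ := lt_of_le_of_lt (pow_le_pow_of_le_one hϑ0 hϑ1.le hi) hn₀
  have hZ : Kζ * ϑ ^ i ≤ Kζ * (m ^ 2 / (Kζ + 1)) := mul_le_mul_of_nonneg_left (hϑi.le.trans (min_le_left _ _)) hKζ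
  have hEε : Kε * ϑ ^ i ≤ Kε * (m / (Kε + 1)) := mul_le_mul_of_nonneg_left (hϑi.le.trans (min_le_right _ _)) hKε
  have hZm : Kζ * (m ^ 2 / (Kζ + 1)) < m ^ 2 := by
    rw [← mul_div_assoc, div_lt_iff₀ (by positivity)]; nlinarith
  have hEm : Kε * (m / (Kε + 1)) < m := by
    rw [← mul_div_assoc, div_lt_iff₀ (by positivity)]; nlinarith
  have hZ0 : 0 ≤ Kζ * ϑ ^ i := by positivity
  have hsq : Real.sqrt (q ^ 2 + Kζ * ϑ ^ i) ≤ q + Real.sqrt (Kζ * ϑ ^ i) := by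
    have h := sqrt_sq_add_le hq (Real.sqrt_nonneg (Kζ * ϑ ^ i)) (le_refl (0:ℝ))
    simp only [add_zero] at h
    calc Real.sqrt (q ^ 2 + Kζ * ϑ ^ i)
        = Real.sqrt ((q + Real.sqrt (Kζ * ϑ ^ i)) ^ 2 - 2 * q * Real.sqrt (Kζ * ϑ ^ i)) := by
          rw [add_sq, Real.sq_sqrt hZ0]; ring_nf
      _ ≤ Real.sqrt ((q + Real.sqrt (Kζ * ϑ ^ i)) ^ 2) :=
          Real.sqrt_le_sqrt (by nlinarith [Real.sqrt_nonneg (Kζ * ϑ ^ i)])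
      _ = q + Real.sqrt (Kζ * ϑ ^ i) := Real.sqrt_sq (by positivity)
  have hsZ : Real.sqrt (Kζ * ϑ ^ i) < m := by
    calc Real.sqrt (Kζ * ϑ ^ i) ≤ Real.sqrt (Kζ * (m ^ 2 / (Kζ + 1))) := Real.sqrt_le_sqrt hZ
      _ < Real.sqrt (m ^ 2) := Real.sqrt_lt_sqrt (by positivity) hZm
      _ = m := Real.sqrt_sq hm0.le
  have : q + m + m = E := by rw [hm]; ring
  linarith [hEε.trans_lt hEm]

/-- **Eventually the thin scale is at most one**: `c(r/ρ₀)^i ≤ 1` for large `i` (`0 ≤ r < ρ₀`). [folklore] -/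
theorem eventually_thinScale_le_one {c r ρ : ℝ} (hr : 0 ≤ r) (hrρ : r < ρ) :
    ∀ᶠ i : ℕ in atTop, c * r ^ i / ρ ^ i ≤ 1 := by
  have hρ : 0 < ρ := lt_of_le_of_lt hr hrρ
  have hq0 : 0 ≤ r / ρ := div_nonneg hr hρ.le
  have hq1 : r / ρ < 1 := (div_lt_one hρ).2 hrρ
  have ht : Tendsto (fun i : ℕ => c * (r / ρ) ^ i) atTop (𝓝 (c * 0)) :=
    (tendsto_pow_atTop_nhds_zero_of_lt_one hq0 hq1).const_mul c
  rw [mul_zero] at ht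
  filter_upwards [ht.eventually (gt_mem_nhds (show (0:ℝ) < 1 by norm_num))] with i hi
  rw [div_pow] at hi
  rw [mul_div_assoc]
  exact hi.le

/-- **Eventually the hand-over radius exceeds the minimal radius**: `L_min ≤ c r^i` for large `i` (`c > 0`, `r > 1`).
[folklore] -/
theorem eventually_le_thinRadius {c r Lm : ℝ} (hc : 0 < c) (hr : 1 < r) :
    ∀ᶠ i : ℕ in atTop, Lm ≤ c * r ^ i :=
  ((tendsto_pow_atTop_atTop_of_one_lt hr).const_mul_atTop hc).eventually_ge_atTop Lm

section Cascade

variable (P : CascadeParams)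

/-! ## §3 The cascade ledger «from phase i₀» closes modulo the first good piece -/

/-- **The cascade ledger from phase `i₀` closes modulo the first good piece (thin start).**  For the cascade at the crux
point (`N₀ = 1`, `ρN = 2`, `d = 2`, `5 ≤ γ ≤ 8`, `0 < δ₀ ≤ 1/4`), a minimal radius `L_min ≥ 1000` fixing the rate `ρ₀`, and
any bounded datum `θ₀ ≠ 0`, there are constants `K_ε, K_ζ ≥ 0` such that for EVERY scale `0 < L₀ ≤ 1`, every start phase
`i₀` with `L_min ≤ L₀ρ₀^{i₀}` and every level `q ≥ 0`: the first-good-piece socket for the start symbol `μᴴ_{i₀}` at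
`(L₀, ρ₀)` (limit form) and the budget `√(q² + (K_ζ/L₀)θ^{i₀}/(1−θ)) + (K_ε/L₀)θ^{i₀}/(1−θ) < ‖θ₀‖`
(`θ = (max(16/ρ₀, ½))^{1/4}`) imply the body of the registered stub `stub_highModeConcentration` for `(P, γ² − 3, θ₀)`.
[cite: DEIJ2022, (1.2)–(1.3)] [cite: ElgindiLissMattingly2025, §1.2 and §3.1] -/
theorem highModeConcentration_of_firstGoodPiece (hγ : 5 ≤ P.γ) (hγ' : P.γ ≤ 8) (hδ₀ : 0 < P.δ₀)
    (hδ₀' : P.δ₀ ≤ 1 / 4) (hd : P.d = 2) (hN₀ : P.N₀ = 1) (hρN : P.ρN = 2) {Lm : ℝ} (hLm : 1000 ≤ Lm)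
    {θ₀ : UnitAddTorus (Fin 2) → ℝ} (hθ₀ : 0 < FluidPDE.Torus.scalarL2Sq θ₀) {B : ℝ} (hB : ∀ x, |θ₀ x| ≤ B) :
    ∃ Kε Kζ : ℝ, 0 ≤ Kε ∧ 0 ≤ Kζ ∧ ∀ L₀ : ℝ, 0 < L₀ → L₀ ≤ 1 → ∀ i₀ : ℕ,
      Lm ≤ L₀ * ((P.γ ^ 2 - 5 / 2) / (1 + 1 / 250) ^ 2 - 1 / (2 * (1 + 1 / 250) * Lm)) ^ i₀ → ∀ q : ℝ, 0 ≤ q →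
      (∀ η : ℝ, 0 < η → ∃ κ₁ : ℝ, 0 < κ₁ ∧ ∀ κ ∈ Ioc (0 : ℝ) κ₁, ∀ w : ℝ → UnitAddTorus (Fin 2) → ℝ,
        FluidPDE.Torus.IsClassicalScalarTransportOn (Ico 0 1) κ P.field w → w 0 = θ₀ →
          Real.sqrt (∑' k : Fin 2 → ℤ, (1 - Real.smoothTransition ((|((k 0 : ℤ) : ℝ)| - L₀ * ((P.γ ^ 2 - 5 / 2) / (1 + 1 / 250) ^ 2 - 1 / (2 * (1 + 1 / 250) * Lm)) ^ i₀) /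
            (1 / 250 * (L₀ * ((P.γ ^ 2 - 5 / 2) / (1 + 1 / 250) ^ 2 - 1 / (2 * (1 + 1 / 250) * Lm)) ^ i₀))) *
          (1 - Real.smoothTransition ((P.γ * |((k 1 : ℤ) : ℝ)| - 13 / 10 * |((k 0 : ℤ) : ℝ)|) /
            (1 / 20 * (L₀ * ((P.γ ^ 2 - 5 / 2) / (1 + 1 / 250) ^ 2 - 1 / (2 * (1 + 1 / 250) * Lm)) ^ i₀)))) *
        ((1 - Real.smoothTransition ((|((k 0 : ℤ) : ℝ)| - 2 * L₀ * ((1 + P.γ) ^ 2 + 1) ^ i₀) /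
            (L₀ * ((P.γ ^ 2 - 5 / 2) / (1 + 1 / 250) ^ 2 - 1 / (2 * (1 + 1 / 250) * Lm)) ^ i₀ / (20 * P.γ * (1 + 1 / 250))))) *
          (1 - Real.smoothTransition ((|((k 1 : ℤ) : ℝ)| - 2 * L₀ * ((1 + P.γ) ^ 2 + 1) ^ i₀) /
            (L₀ * ((P.γ ^ 2 - 5 / 2) / (1 + 1 / 250) ^ 2 - 1 / (2 * (1 + 1 / 250) * Lm)) ^ i₀ / (20 * P.γ * (1 + 1 / 250))))))) ^ 2 *
            ‖mFourierCoeff (fun x => (w (tStart i₀) x : ℂ)) k‖ ^ 2) ≤ q + η) →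
      Real.sqrt (q ^ 2 + Kζ / L₀ * Real.sqrt (Real.sqrt (max (16 / ((P.γ ^ 2 - 5 / 2) / (1 + 1 / 250) ^ 2 - 1 / (2 * (1 + 1 / 250) * Lm))) (1 / 2))) ^ i₀ /
          (1 - Real.sqrt (Real.sqrt (max (16 / ((P.γ ^ 2 - 5 / 2) / (1 + 1 / 250) ^ 2 - 1 / (2 * (1 + 1 / 250) * Lm))) (1 / 2))))) +
        Kε / L₀ * Real.sqrt (Real.sqrt (max (16 / ((P.γ ^ 2 - 5 / 2) / (1 + 1 / 250) ^ 2 - 1 / (2 * (1 + 1 / 250) * Lm))) (1 / 2))) ^ i₀ /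
          (1 - Real.sqrt (Real.sqrt (max (16 / ((P.γ ^ 2 - 5 / 2) / (1 + 1 / 250) ^ 2 - 1 / (2 * (1 + 1 / 250) * Lm))) (1 / 2)))) <
        Real.sqrt (FluidPDE.Torus.scalarL2Sq θ₀) →
      ∃ χ : ℝ, 0 < χ ∧ ∃ A' : ℕ, ∃ κ₀ : ℝ, 0 < κ₀ ∧ ∀ κ ∈ Ioc (0 : ℝ) κ₀,
      ∀ w : ℝ → UnitAddTorus (Fin 2) → ℝ,
        FluidPDE.Torus.IsClassicalScalarTransportOn (Ico 0 1) κ P.field w → w 0 = θ₀ →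
        ∃ K : ℝ, 0 ≤ K ∧ 1 ≤ 8 * Real.pi ^ 2 * κ * K ^ 2 * tHalf (Jrate (P.γ ^ 2 - 3) κ + A') ∧
          ENNReal.ofReal (2 * χ * FluidPDE.Torus.scalarL2Sq θ₀) ≤
            highModeEnergy 0 K (w (tStart (Jrate (P.γ ^ 2 - 3) κ + A'))) +
              2 * FluidPDE.Torus.eScalarDissipation κ w 0 (tStart (Jrate (P.γ ^ 2 - 3) κ + A')) := by
  have hr1 : 1 < P.γ ^ 2 - 3 := one_lt_rate hγ
  have hrρ : P.γ ^ 2 - 3 < ((P.γ ^ 2 - 5 / 2) / (1 + 1 / 250) ^ 2 - 1 / (2 * (1 + 1 / 250) * Lm)) := rate_lt_rho hγ hγ' hLm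
  have hr22 : (22 : ℝ) ≤ P.γ ^ 2 - 3 := by nlinarith
  have hρ16 : 16 < ((P.γ ^ 2 - 5 / 2) / (1 + 1 / 250) ^ 2 - 1 / (2 * (1 + 1 / 250) * Lm)) := by linarith
  obtain ⟨-, hθ1, hθ0⟩ := theta_facts hρ16
  obtain ⟨KεH, KζH, hKεH, hKζH, HH⟩ := exists_geometric_hstepH_from P hγ hγ' hδ₀ hδ₀' hd hN₀ hρN hLm (θ₀ := θ₀) hB
  obtain ⟨KεV, KζV, hKεV, hKζV, HV⟩ := exists_geometric_hstepV_from P hγ hγ' hδ₀ hδ₀' hd hN₀ hρN hLm (θ₀ := θ₀) hB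
  refine ⟨KεH + KεV, KζH + KζV, by positivity, by positivity, ?_⟩
  intro L₀ hL0 hL1 i₀ hLi q hq hstart hbudget
  rw [add_div KζH KζV L₀, add_div KεH KεV L₀] at hbudget
  exact highModeConcentration_of_geometric_ledger' P hr1 hrρ hL0 hθ₀
    (fun (j : ℕ) (k : Fin 2 → ℤ) => 1 - Real.smoothTransition ((|((k 0 : ℤ) : ℝ)| - L₀ * ((P.γ ^ 2 - 5 / 2) / (1 + 1 / 250) ^ 2 - 1 / (2 * (1 + 1 / 250) * Lm)) ^ j) /
            (1 / 250 * (L₀ * ((P.γ ^ 2 - 5 / 2) / (1 + 1 / 250) ^ 2 - 1 / (2 * (1 + 1 / 250) * Lm)) ^ j))) *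
          (1 - Real.smoothTransition ((P.γ * |((k 1 : ℤ) : ℝ)| - 13 / 10 * |((k 0 : ℤ) : ℝ)|) /
            (1 / 20 * (L₀ * ((P.γ ^ 2 - 5 / 2) / (1 + 1 / 250) ^ 2 - 1 / (2 * (1 + 1 / 250) * Lm)) ^ j)))) *
        ((1 - Real.smoothTransition ((|((k 0 : ℤ) : ℝ)| - 2 * L₀ * ((1 + P.γ) ^ 2 + 1) ^ j) /
            (L₀ * ((P.γ ^ 2 - 5 / 2) / (1 + 1 / 250) ^ 2 - 1 / (2 * (1 + 1 / 250) * Lm)) ^ j / (20 * P.γ * (1 + 1 / 250))))) *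
          (1 - Real.smoothTransition ((|((k 1 : ℤ) : ℝ)| - 2 * L₀ * ((1 + P.γ) ^ 2 + 1) ^ j) /
            (L₀ * ((P.γ ^ 2 - 5 / 2) / (1 + 1 / 250) ^ 2 - 1 / (2 * (1 + 1 / 250) * Lm)) ^ j / (20 * P.γ * (1 + 1 / 250)))))))
    (fun (j : ℕ) (k : Fin 2 → ℤ) => 1 - Real.smoothTransition ((|((k 0 : ℤ) : ℝ)| -
              L₀ * ((P.γ ^ 2 - 5 / 2) / (1 + 1 / 250) ^ 2 - 1 / (2 * (1 + 1 / 250) * Lm)) ^ j / (1 + 1 / 250)) /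
            (1 / 250 * (L₀ * ((P.γ ^ 2 - 5 / 2) / (1 + 1 / 250) ^ 2 - 1 / (2 * (1 + 1 / 250) * Lm)) ^ j / (1 + 1 / 250)))) *
          (1 - Real.smoothTransition ((P.γ * |((k 1 : ℤ) : ℝ) + P.γ * ((k 0 : ℤ) : ℝ)| - 29 / 20 * |((k 0 : ℤ) : ℝ)|) /
              (1 / 20 * (L₀ * ((P.γ ^ 2 - 5 / 2) / (1 + 1 / 250) ^ 2 - 1 / (2 * (1 + 1 / 250) * Lm)) ^ j / (1 + 1 / 250)))) *
            Real.smoothTransition ((P.γ * |((k 1 : ℤ) : ℝ) - P.γ * ((k 0 : ℤ) : ℝ)| - 29 / 20 * |((k 0 : ℤ) : ℝ)|) /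
              (1 / 20 * (L₀ * ((P.γ ^ 2 - 5 / 2) / (1 + 1 / 250) ^ 2 - 1 / (2 * (1 + 1 / 250) * Lm)) ^ j / (1 + 1 / 250))))) *
        ((1 - Real.smoothTransition ((|((k 0 : ℤ) : ℝ)| -
              ((1 + P.γ) * (2 * L₀ * ((1 + P.γ) ^ 2 + 1) ^ j +
                L₀ * ((P.γ ^ 2 - 5 / 2) / (1 + 1 / 250) ^ 2 - 1 / (2 * (1 + 1 / 250) * Lm)) ^ j / (20 * P.γ * (1 + 1 / 250))) +
                1 / 2)) /
            (L₀ * ((P.γ ^ 2 - 5 / 2) / (1 + 1 / 250) ^ 2 - 1 / (2 * (1 + 1 / 250) * Lm)) ^ j / (20 * P.γ * (1 + 1 / 250))))) *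
          (1 - Real.smoothTransition ((|((k 1 : ℤ) : ℝ)| -
              ((1 + P.γ) * (2 * L₀ * ((1 + P.γ) ^ 2 + 1) ^ j +
                L₀ * ((P.γ ^ 2 - 5 / 2) / (1 + 1 / 250) ^ 2 - 1 / (2 * (1 + 1 / 250) * Lm)) ^ j / (20 * P.γ * (1 + 1 / 250))) +
                1 / 2)) /
            (L₀ * ((P.γ ^ 2 - 5 / 2) / (1 + 1 / 250) ^ 2 - 1 / (2 * (1 + 1 / 250) * Lm)) ^ j / (20 * P.γ * (1 + 1 / 250)))))))
    (fun j k => From.abs_muH_le_one P.γ Lm L₀ j k) (i₀ := i₀)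
    (fun J _ k hk => From.one_le_muH_sq_of_lt hγ hγ' hLm hL0 J k hk)
    (div_nonneg hKεH hL0.le) (div_nonneg hKζH hL0.le) (div_nonneg hKεV hL0.le) (div_nonneg hKζV hL0.le) hθ0 hθ1
    one_pos
    (fun κ hκ w hw h0 j hj hjJ => HH L₀ hL0 hL1 i₀ hLi κ hκ w hw h0 j hj hjJ)
    (fun κ hκ w hw h0 j hj hjJ => HV L₀ hL0 hL1 i₀ hLi κ hκ w hw h0 j hj hjJ) hq hstart hbudget

/-! ## §4 `K1Localised` from a THIN first good piece -/

/-- **`K1Localised P (γ² − 3)` from a THIN uniform first good piece.**  For the cascade at the crux point with symbolic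
`δ₀` (`N₀ = 1`, `ρN = 2`, `d = 2`, `5 ≤ γ ≤ 8`, `0 < δ₀ ≤ 1/4`), a minimal radius `L_min ≥ 1000` (fixing `ρ₀`) and ANY
`c > 0`: if for ONE level `q < ‖datum‖` and ALL start phases `i₀ ≥ i₁` the first-good-piece socket holds for the start symbol
with tracked radius `c(γ²−3)^{i₀}` — BELOW the deterministic frequency floor `(γ²−3)^{i₀}` of the inviscid iterate when
`c < 1` — (envelope `2c(γ²−3)^{i₀}(Γ/ρ₀)^{i₀}`, width `c(γ²−3)^{i₀}/(20γ(1+1/250))`), then `K1Localised P (γ² − 3)`.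
The ledger runs from phase `i₀` at scale `L₀ = c(γ²−3)^{i₀}/ρ₀^{i₀}`; its errors `(K/L₀)θ^{i₀} = (K/c)(ρ₀θ/(γ²−3))^{i₀}`
still vanish because `ρ₀θ < γ² − 3` (`rho_mul_theta_lt_rate`). [cite: DEIJ2022, (1.2)–(1.3)] [cite: ElgindiLissMattingly2025, §1.2 and §3.1] -/
theorem k1Localised_of_thin_firstGoodPiece (hγ : 5 ≤ P.γ) (hγ' : P.γ ≤ 8) (hδ₀ : 0 < P.δ₀) (hδ₀' : P.δ₀ ≤ 1 / 4)
    (hd : P.d = 2) (hN₀ : P.N₀ = 1) (hρN : P.ρN = 2) {Lm : ℝ} (hLm : 1000 ≤ Lm) (hE : 0 < Torus.scalarL2Sq datum)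
    {c : ℝ} (hc : 0 < c) {q : ℝ} (hq : 0 ≤ q) (hqE : q < Real.sqrt (Torus.scalarL2Sq datum)) {i₁ : ℕ}
    (hstart : ∀ i₀ : ℕ, i₁ ≤ i₀ →
      ∀ η : ℝ, 0 < η → ∃ κ₁ : ℝ, 0 < κ₁ ∧ ∀ κ ∈ Ioc (0 : ℝ) κ₁, ∀ w : ℝ → UnitAddTorus (Fin 2) → ℝ,
        FluidPDE.Torus.IsClassicalScalarTransportOn (Ico 0 1) κ P.field w → w 0 = datum →
          Real.sqrt (∑' k : Fin 2 → ℤ, (1 - Real.smoothTransition ((|((k 0 : ℤ) : ℝ)| - c * (P.γ ^ 2 - 3) ^ i₀) /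
            (1 / 250 * (c * (P.γ ^ 2 - 3) ^ i₀))) *
          (1 - Real.smoothTransition ((P.γ * |((k 1 : ℤ) : ℝ)| - 13 / 10 * |((k 0 : ℤ) : ℝ)|) /
            (1 / 20 * (c * (P.γ ^ 2 - 3) ^ i₀)))) *
        ((1 - Real.smoothTransition ((|((k 0 : ℤ) : ℝ)| - 2 * (c * (P.γ ^ 2 - 3) ^ i₀ / ((P.γ ^ 2 - 5 / 2) / (1 + 1 / 250) ^ 2 - 1 / (2 * (1 + 1 / 250) * Lm)) ^ i₀) * ((1 + P.γ) ^ 2 + 1) ^ i₀) /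
            (c * (P.γ ^ 2 - 3) ^ i₀ / (20 * P.γ * (1 + 1 / 250))))) *
          (1 - Real.smoothTransition ((|((k 1 : ℤ) : ℝ)| - 2 * (c * (P.γ ^ 2 - 3) ^ i₀ / ((P.γ ^ 2 - 5 / 2) / (1 + 1 / 250) ^ 2 - 1 / (2 * (1 + 1 / 250) * Lm)) ^ i₀) * ((1 + P.γ) ^ 2 + 1) ^ i₀) /
            (c * (P.γ ^ 2 - 3) ^ i₀ / (20 * P.γ * (1 + 1 / 250))))))) ^ 2 *
            ‖mFourierCoeff (fun x => (w (tStart i₀) x : ℂ)) k‖ ^ 2) ≤ q + η) :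
    K1Localised P (P.γ ^ 2 - 3) := by
  have hr1 : 1 < P.γ ^ 2 - 3 := one_lt_rate hγ
  have hr0 : 0 < P.γ ^ 2 - 3 := by linarith
  have hrρ : P.γ ^ 2 - 3 < ((P.γ ^ 2 - 5 / 2) / (1 + 1 / 250) ^ 2 - 1 / (2 * (1 + 1 / 250) * Lm)) := rate_lt_rho hγ hγ' hLm
  have hρ0 : 0 < ((P.γ ^ 2 - 5 / 2) / (1 + 1 / 250) ^ 2 - 1 / (2 * (1 + 1 / 250) * Lm)) := rho_pos hγ hγ' hLm
  have hr22 : (22 : ℝ) ≤ P.γ ^ 2 - 3 := by nlinarith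
  have hρ16 : 16 < ((P.γ ^ 2 - 5 / 2) / (1 + 1 / 250) ^ 2 - 1 / (2 * (1 + 1 / 250) * Lm)) := by linarith
  obtain ⟨-, hθ1, hθ0⟩ := theta_facts hρ16
  have h1θ : 0 < 1 - Real.sqrt (Real.sqrt (max (16 / ((P.γ ^ 2 - 5 / 2) / (1 + 1 / 250) ^ 2 - 1 / (2 * (1 + 1 / 250) * Lm))) (1 / 2))) := by linarith
  obtain ⟨hϑ0, hϑ1⟩ := thinRate_nonneg_lt_one hγ hγ' hLm
  obtain ⟨Kε, Kζ, hKε, hKζ, hmain⟩ :=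
    highModeConcentration_of_firstGoodPiece P hγ hγ' hδ₀ hδ₀' hd hN₀ hρN hLm hE (B := 1) (fun _ => Real.abs_sin_le_one _)
  -- a start phase at which the scale is `≤ 1`, the radius is `≥ L_min`, the budget holds, and `i₁ ≤ i₀`
  have e1 := eventually_thinScale_le_one (c := c) hr0.le hrρ
  have e2 := eventually_le_thinRadius (Lm := Lm) hc hr1
  have e3 := eventually_budget (Kε := Kε / (c * (1 - Real.sqrt (Real.sqrt (max (16 / ((P.γ ^ 2 - 5 / 2) / (1 + 1 / 250) ^ 2 - 1 / (2 * (1 + 1 / 250) * Lm))) (1 / 2))))))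
    (Kζ := Kζ / (c * (1 - Real.sqrt (Real.sqrt (max (16 / ((P.γ ^ 2 - 5 / 2) / (1 + 1 / 250) ^ 2 - 1 / (2 * (1 + 1 / 250) * Lm))) (1 / 2)))))) hq hqE (by positivity) (by positivity) hϑ0 hϑ1
  obtain ⟨i₀, ⟨⟨hi1, hi2⟩, hi3⟩, hi4⟩ := (((e1.and e2).and e3).and (eventually_ge_atTop i₁)).exists
  have hL0 : 0 < c * (P.γ ^ 2 - 3) ^ i₀ / ((P.γ ^ 2 - 5 / 2) / (1 + 1 / 250) ^ 2 - 1 / (2 * (1 + 1 / 250) * Lm)) ^ i₀ := by positivity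
  have heq : c * (P.γ ^ 2 - 3) ^ i₀ / ((P.γ ^ 2 - 5 / 2) / (1 + 1 / 250) ^ 2 - 1 / (2 * (1 + 1 / 250) * Lm)) ^ i₀ * ((P.γ ^ 2 - 5 / 2) / (1 + 1 / 250) ^ 2 - 1 / (2 * (1 + 1 / 250) * Lm)) ^ i₀ = c * (P.γ ^ 2 - 3) ^ i₀ :=
    div_mul_cancel₀ _ (pow_ne_zero _ hρ0.ne')
  refine k1Localised_of_highModeConcentration P (P.γ ^ 2 - 3)
    (hmain (c * (P.γ ^ 2 - 3) ^ i₀ / ((P.γ ^ 2 - 5 / 2) / (1 + 1 / 250) ^ 2 - 1 / (2 * (1 + 1 / 250) * Lm)) ^ i₀) hL0 hi1 i₀ (by rw [heq]; exact hi2) q hq ?_ ?_)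
  · simp only [heq]
    exact hstart i₀ hi4
  · rw [div_thinScale_mul_pow hc.ne' hr0.ne' hρ0.ne' h1θ.ne' i₀, div_thinScale_mul_pow hc.ne' hr0.ne' hρ0.ne' h1θ.ne' i₀]
    exact hi3

/-! ## §5 `K1Localised` from a THIN uniform bound on the inviscid iterates -/

/-- **`K1Localised P (γ² − 3)` from a THIN uniform bound on the inviscid iterates of the datum** (S-B ∘ S-D transfer,
PDE-free hypothesis).  As `k1Localised_of_thin_firstGoodPiece`, with the socket replaced by ONE bound `q < ‖datum‖` on the
tracked start energy `√(Σ μᴴ_n(k)²|𝓕a_n(k)|²)` of the explicit inviscid iterates `a_n` (`a 0 = datum`,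
`b j = a j ∘ Φ_{H,j}⁻¹`, `a (j+1) = b j ∘ Φ_{V,j}⁻¹`) for all `n ≥ i₁`, the symbol `μᴴ_n` having tracked radius `c(γ²−3)^n`
(`…K1Start.sqrt_tsum_symbol_sq_datum_le_of_inviscid` supplies the `κ → 0` transfer, `κ₁` free).
[cite: DEIJ2022, (1.2)–(1.3)] [cite: BedrossianCotiZelati2017, §2] -/
theorem k1Localised_of_thin_iterate_bound (hγ : 5 ≤ P.γ) (hγ' : P.γ ≤ 8) (hδ₀ : 0 < P.δ₀) (hδ₀' : P.δ₀ ≤ 1 / 4)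
    (hd : P.d = 2) (hN₀ : P.N₀ = 1) (hρN : P.ρN = 2) {Lm : ℝ} (hLm : 1000 ≤ Lm) (hE : 0 < Torus.scalarL2Sq datum)
    (a b : ℕ → UnitAddTorus (Fin 2) → ℝ) (has : ∀ j, IsSmooth (a j)) (h0 : a 0 = datum)
    (hb : ∀ j, b j = a j ∘ shearMap 0 1 (amp ⟨P.U j, P.U_periodic j, P.contDiff_U (P.δ_pos hδ₀ (by rw [hd]; norm_num) j)⟩ P.γ))
    (hab : ∀ j, a (j + 1) = b j ∘ shearMap 1 0 (amp ⟨P.U j, P.U_periodic j, P.contDiff_U (P.δ_pos hδ₀ (by rw [hd]; norm_num) j)⟩ P.γ))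
    {c : ℝ} (hc : 0 < c) {q : ℝ} (hq : 0 ≤ q) (hqE : q < Real.sqrt (Torus.scalarL2Sq datum)) {i₁ : ℕ}
    (hiter : ∀ n : ℕ, i₁ ≤ n →
      Real.sqrt (∑' k : Fin 2 → ℤ, (1 - Real.smoothTransition ((|((k 0 : ℤ) : ℝ)| - c * (P.γ ^ 2 - 3) ^ n) /
            (1 / 250 * (c * (P.γ ^ 2 - 3) ^ n))) *
          (1 - Real.smoothTransition ((P.γ * |((k 1 : ℤ) : ℝ)| - 13 / 10 * |((k 0 : ℤ) : ℝ)|) /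
            (1 / 20 * (c * (P.γ ^ 2 - 3) ^ n)))) *
        ((1 - Real.smoothTransition ((|((k 0 : ℤ) : ℝ)| - 2 * (c * (P.γ ^ 2 - 3) ^ n / ((P.γ ^ 2 - 5 / 2) / (1 + 1 / 250) ^ 2 - 1 / (2 * (1 + 1 / 250) * Lm)) ^ n) * ((1 + P.γ) ^ 2 + 1) ^ n) /
            (c * (P.γ ^ 2 - 3) ^ n / (20 * P.γ * (1 + 1 / 250))))) *
          (1 - Real.smoothTransition ((|((k 1 : ℤ) : ℝ)| - 2 * (c * (P.γ ^ 2 - 3) ^ n / ((P.γ ^ 2 - 5 / 2) / (1 + 1 / 250) ^ 2 - 1 / (2 * (1 + 1 / 250) * Lm)) ^ n) * ((1 + P.γ) ^ 2 + 1) ^ n) /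
            (c * (P.γ ^ 2 - 3) ^ n / (20 * P.γ * (1 + 1 / 250))))))) ^ 2 * ‖mFourierCoeff (fun x => (a n x : ℂ)) k‖ ^ 2) ≤ q) :
    K1Localised P (P.γ ^ 2 - 3) := by
  have hγ0 : 0 ≤ P.γ := by linarith
  have hd0 : 0 < P.d := by rw [hd]; norm_num
  have hE0 : 0 ≤ Torus.scalarL2Sq datum := hE.le
  refine k1Localised_of_thin_firstGoodPiece P hγ hγ' hδ₀ hδ₀' hd hN₀ hρN hLm hE hc hq hqE (i₁ := i₁) ?_
  intro i₀ hi η hη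
  -- the enstrophy constant of the first `i₀` phases and the threshold `κ₁(η)`
  set A : ℝ := 2 * Real.pi * Real.sqrt (1 + (1 + P.γ) ^ 2) * (1 + P.γ) ^ (2 * i₀) with hA
  have hA0 : 0 ≤ A := by positivity
  have hT0 : 0 ≤ tStart i₀ := tStart_nonneg i₀
  set κ₁ : ℝ := η ^ 4 / (A ^ 2 * (2 * tStart i₀ * Torus.scalarL2Sq datum) + 1) with hκ₁
  have hκ₁0 : 0 < κ₁ := by positivity
  refine ⟨κ₁, hκ₁0, fun κ hκ w hw hw0 => ?_⟩
  have h := sqrt_tsum_symbol_sq_datum_le_of_inviscid P hγ0 hδ₀ hd0 a b has h0 hb hab i₀ _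
    (fun k => abs_symProdS_le_one P.γ (1 / 250) (1 / 20) (13 / 10) (c * (P.γ ^ 2 - 3) ^ i₀)
      (2 * (c * (P.γ ^ 2 - 3) ^ i₀ / ((P.γ ^ 2 - 5 / 2) / (1 + 1 / 250) ^ 2 - 1 / (2 * (1 + 1 / 250) * Lm)) ^ i₀) * ((1 + P.γ) ^ 2 + 1) ^ i₀)
      (c * (P.γ ^ 2 - 3) ^ i₀ / (20 * P.γ * (1 + 1 / 250))) (k 0) (k 1))
    (κ₁ := κ₁) (hiter i₀ hi) κ hκ w hw hw0
  refine h.trans (add_le_add le_rfl ?_)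
  refine Real.sqrt_le_iff.2 ⟨hη.le, ?_⟩
  exact mul_sqrt_threshold_le (η := η) hA0 hT0 hE0

end Cascade

end Summit.AnomalousDissipation.AnomalousDissipation.Theorems.SawtoothPulseCascade.K1Ledger.From
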